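import Summits.NavierStokesRegularity.NavierStokesRegularity.Theorems.AxisTwistDoorAveragedConeLiouvilleNUEnergyClassFrame
import Summits.NavierStokesRegularity.NavierStokesRegularity.Theorems.AxisTwistDoorAveragedConeLiouvilleNUEnergyIneqOfWeak
import Summits.NavierStokesRegularity.NavierStokesRegularity.Theorems.AxisTwistDoorAveragedConeLiouvilleNUWeakTimeCutoff
import Summits.NavierStokesRegularity.NavierStokesRegularity.Theorems.AxisTwistDoorAveragedConeLiouvilleNUStandingTools
import Summits.NavierStokesRegularity.NavierStokesRegularity.Theorems.AxisTwistDoorAveragedConeLiouvilleNUWeakDefs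
import Summits.NavierStokesRegularity.NavierStokesRegularity.Theorems.AxisTwistDoorAveragedConeLiouvilleNUWeakEnergyW1
import HarnessLib

/-!
# Route `AxisTwistDoor`, crux `AveragedConeLiouville` (stmt-NavierStokesRegularity-26889) — INPUT N4 / T1, piece W (N-W part 2):
# WEAK LIPSCHITZ DATA ⇒ `NUStandingLip` FRAMES — `stub_nu_standing_of_weak_of_identity` BY NAME

T1 kit `kits/N4-T1-skeleton.lean` 118454bf17607d1e, stub l.234 `Sig.nu_weakEnergyIdentity → Sig.nu_standing_of_weak` (tree texts
`…NUWeakDefs` p639785 / `…NULipDefs` p638908).  This file is the W ASSEMBLY — pure plumbing over the landed bricks of the pub/ns-inputs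
cell (2026-08-28): given `Λ ≥ 0` the drift constant is `nuDriftConst Λ` (ns-in-ser-a g3, (c) p640912); given the weak data and a frame
`(k, t⋆, τ, R)`, the time cut-off `ψ(s) = smoothTransition(2s/t⋆ − 1)` (`timeCutoff_props`) turns `(V, b)` into the pair `(ψV, b)` which
keeps the typed weak clause (`weak_clause_time_cutoff'`, ns-in-ser-b g2, (W0) p640988); W1 (the HYPOTHESIS `Sig.nu_weakEnergyIdentity`,
proved as `nu_weakEnergyIdentity` p640099 by ns-in-ser-b g2) and the divergence-free transfer + absorption give the `NUEnergyClass`-shaped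
slab inequalities for `(ψV, b)` (`nu_energyIneq_of_weak`, this seat, (a) p640063 · (b1) p640527 · (b) p641076); the frame packaging
`exists_nuStandingLip_frame_of_energyIneq` (ns-in-ser-a g3, (c2)) returns the `NUStandingLip` frame with the identification
`Φ(t,x) = V(t+τ,x)` on `{t⋆ ≤ t+τ, t < 0, |x| < 2R}`.

* `nu_standing_of_weak_of_identity : Sig.nu_weakEnergyIdentity → Sig.nu_standing_of_weak` (kit l.234 BY NAME);
* `nu_standing_of_weak : Sig.nu_standing_of_weak` (W discharged with W1 = `nu_weakEnergyIdentity`).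

No NS statement is touched; T1 is an INPUT (a printed theorem re-proved); item 26889 and the summit are not affected.
`--supports stmt-NavierStokesRegularity-26889 --as helper`. [cite: NazarovUraltseva2011HarnackDivFree, §3 (arXiv:1011.1888 p. 8)]
-/

noncomputable section

-- the summit and its single sub-problem share the name (CONVENTIONS §1)
set_option linter.dupNamespace false

open MeasureTheory Set Function Filter Topology Metric
open scoped NNReal ENNReal InnerProductSpace RealInnerProductSpace

namespace Summit.NavierStokesRegularity.NavierStokesRegularity.Theorems.AveragedConeLiouville.NUPositivity

/-- **W = `stub_nu_standing_of_weak_of_identity` of the T1 kit BY NAME: weak Lipschitz data ⇒ `NUStandingLip` frames, given W1.**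
[cite: NazarovUraltseva2011HarnackDivFree, §3 (arXiv:1011.1888 p. 8)] -/
theorem nu_standing_of_weak_of_identity : Sig.nu_weakEnergyIdentity → Sig.nu_standing_of_weak := by
  intro hW1 Λ hΛ
  refine ⟨nuDriftConst Λ, ?_⟩
  intro T V b hbm hbΛ hdiv hVlip hV0 hweak k tstar τ R hk htstar _ hτT hR h2R
  -- the time cut-off `ψ(s) = smoothTransition(s/(t⋆/2) − 1)`
  have ha : 0 < tstar / 2 := by positivity
  obtain ⟨hψC2, hψ01, hψz, hψ1', hψ'⟩ := timeCutoff_props ha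
  have hψ1 : ∀ s, tstar ≤ s → Real.smoothTransition (s / (tstar / 2) - 1) = 1 :=
    fun s hs => hψ1' s (by linarith)
  have hψC1 : ContDiff ℝ 1 (fun s : ℝ => Real.smoothTransition (s / (tstar / 2) - 1)) := hψC2.of_le (by norm_num)
  -- (W0): the pair `(ψV, b)` keeps the typed weak clause
  obtain ⟨hLip', hV0', hweak'⟩ := weak_clause_time_cutoff' (b := b) hVlip hV0 hweak hψC1 hψ01 hψ' hψz hψ1
  -- (b): the slab energy inequalities of `(ψV, b)` on `]0,T[`
  have hE := nu_energyIneq_of_weak hW1 hbm hbΛ hdiv hLip' hV0' hweak'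
  -- (c2) + (c): the frame
  exact exists_nuStandingLip_frame_of_energyIneq hΛ hbm hbΛ hVlip hV0 hk htstar hτT hR h2R hψC2.continuous hψ01 hψz hψ1
    (fun H h1 h2 h3 h4 h5 Θ hΘ hΘc ρ₀ hρ hs η hη hη0 t₁ t₂ ha' hb' hc' => by
      simpa only [nuSlabIneq] using hE H h1 h2 h3 h4 h5 Θ hΘ hΘc ρ₀ hρ hs η hη hη0 t₁ t₂ ha' hb' hc')

/-- **W discharged: `Sig.nu_standing_of_weak` holds** (W1 = `nu_weakEnergyIdentity`, p640099). -/
theorem nu_standing_of_weak : Sig.nu_standing_of_weak :=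
  nu_standing_of_weak_of_identity nu_weakEnergyIdentity

end Summit.NavierStokesRegularity.NavierStokesRegularity.Theorems.AveragedConeLiouville.NUPositivity

end
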